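import Literature.NumberTheory.LFunctions.WeilExplicitFormulaProofs
import Literature.NumberTheory.LFunctions.WeilExplicitRightEdge
import Literature.NumberTheory.LFunctions.WeilMellinInversion
import Literature.NumberTheory.LFunctions.WeilMellinPolyDecay
import Mathlib.Analysis.SpecialFunctions.ImproperIntegrals
import Mathlib.Analysis.Calculus.Deriv.Support
import HarnessLib

/-!
# Pieces of the relative explicit formula on the window `[-log 3, log 3]`

Sibling of `WeilExplicitFormulaProofs.lean` (the Guinand–Weil explicit formula for `ζ` by the contour
argument of E. Bombieri, *Remarks on Weil's quadratic functional in the theory of prime numbers I*,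
Rend. Lincei (9) 11 (2000), §2, Theorem 2). When the same contour argument is run for a second entire
function `E` with `ζ`'s polar part, Gamma factor and first two Dirichlet terms `1 + 2^{-s}` (all further
frequencies `≥ 3`) and SUBTRACTED from the one for `ξ₂ = 2ξ`, only generic analysis of the Weil
transform `ĝ = weilMellin g` is needed beyond the explicit formula itself. This file supplies those
generic pieces (no arithmetic input other than the tree's `explicit_formula_holds`):

* `tendsto_horizontal_mul_weilMellin` — horizontal sides of the rectangle tend to `0` along heights
  `|e_n| ≥ n + 1` whenever the other factor grows at most polynomially in `n` (decay of `ĝ` of every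
  polynomial order on vertical strips, `norm_weilMellin_le_pow_of_abs_re_le` of
  `WeilMellinPolyDecay.lean`; Bombieri §2: "`f̃` is rapidly decreasing on vertical lines");
* `finsum_box_eq_weilZeroSidePartial` — for `F = c·ξ` (`c ≠ 0`) the weighted zero sum of the residue
  theorem over the box `(1-σ, σ) × (-T, T)`, `σ ≥ 1`, `T` a good height, IS the truncated zero side
  `weilZeroSidePartial g T` of `WeilExplicit.lean` (multiplicities `untop₀_meromorphicOrderAt_riemannXi`);
* `norm_weilMellin_window_le`, `norm_vertical_integral_window_le` — for `g` supported in the window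
  `[-log 3, log 3]`: `|s - 1/2|⁴ |ĝ(s)| ≤ 3^{A} ‖g⁗‖₁` on `|Re s - 1/2| ≤ A`, whence a vertical integral
  `∫ V(y) k̂(σ+iy) dy` against a factor `|V| ≤ C 3^{-σ}` is `O(C/(σ-1/2)²)` UNIFORMLY in `σ ≥ 3/2`
  (the growth `3^{σ-1/2}` of `ĝ` is exactly cancelled by the decay `3^{-σ}`: window-invisibility);
* `two_pi_mul_sub_eq_of_contour_limits` — the bookkeeping of limits for the difference of two contour
  identities.

## References

* E. Bombieri, *Remarks on Weil's quadratic functional in the theory of prime numbers I*, Rend.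
  Mat. Acc. Lincei (9) 11 (2000), 183–233, §2, Theorem 2. [Bombieri2000Weil]
* A. Weil, *Sur les "formules explicites" de la théorie des nombres premiers*, Comm. Sém. Math.
  Univ. Lund (1952), 252–265. [Weil1952]
-/

noncomputable section

open Complex Filter Set MeasureTheory
open scoped Real Topology Interval

namespace Literature.NumberTheory.LFunctions

variable {g : ℝ → ℂ}

/-! ### Horizontal sides along good heights -/

/-- On `Ι a b` one has `|x - 1/2| ≤ |a| + |b| + 1/2`. [folklore] -/
theorem abs_sub_half_le_of_mem_uIoc {a b x : ℝ} (hx : x ∈ Ι a b) : |x - 1 / 2| ≤ |a| + |b| + 1 / 2 := by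
  rw [Set.mem_uIoc] at hx
  have ha := abs_nonneg a
  have hb := abs_nonneg b
  have h1 : -(|a| + |b|) ≤ x := by
    rcases hx with ⟨h, -⟩ | ⟨h, -⟩ <;> linarith [neg_abs_le a, neg_abs_le b]
  have h2 : x ≤ |a| + |b| := by
    rcases hx with ⟨-, h⟩ | ⟨-, h⟩ <;> linarith [le_abs_self a, le_abs_self b]
  rw [abs_le]
  constructor <;> linarith

/-- **The horizontal sides tend to `0` along good heights.** If `|e_n| ≥ n + 1` and the factors
`F_n` satisfy `‖F_n(x)‖ ≤ C (2 + n)^k` on `Ι a b`, then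
`∫_a^b F_n(x) ĝ(x + i e_n) dx → 0` (decay of `ĝ` of order `k + 1` on the strip; Bombieri §2: the
horizontal integrals vanish in the limit along a well-chosen sequence of heights).
[cite: Bombieri2000Weil, §2] -/
theorem tendsto_horizontal_mul_weilMellin (hg : IsWeilTest g) (a b : ℝ) (e : ℕ → ℝ)
    (he : ∀ n : ℕ, (n : ℝ) + 1 ≤ |e n|) (F : ℕ → ℝ → ℂ) (C : ℝ) (k : ℕ)
    (hF : ∀ n : ℕ, ∀ x ∈ Ι a b, ‖F n x‖ ≤ C * (1 + ((n : ℝ) + 1)) ^ k) :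
    Tendsto (fun n : ℕ ↦ ∫ x in a..b, F n x * weilMellin g (x + e n * I)) atTop (𝓝 0) := by
  obtain ⟨D, hD0, hD⟩ := norm_weilMellin_le_pow_of_abs_re_le hg (|a| + |b| + 1 / 2) (k + 1)
  rw [tendsto_zero_iff_norm_tendsto_zero]
  have hmaj : Tendsto (fun n : ℕ ↦ |C| * 2 ^ k * D * |b - a| * (1 / ((n : ℝ) + 1))) atTop (𝓝 0) := by
    simpa using tendsto_one_div_add_atTop_nhds_zero_nat.const_mul (|C| * 2 ^ k * D * |b - a|)
  refine squeeze_zero (fun _ ↦ norm_nonneg _) (fun n ↦ ?_) hmaj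
  set N : ℝ := (n : ℝ) + 1 with hN
  have hN1 : 1 ≤ N := by rw [hN]; linarith [(n.cast_nonneg : (0 : ℝ) ≤ n)]
  have hN0 : 0 < N := by linarith
  -- pointwise bound on the segment
  have hpt : ∀ x ∈ Ι a b, ‖F n x * weilMellin g (x + e n * I)‖ ≤
      |C| * (1 + N) ^ k * (D / (1 + (e n) ^ 2) ^ (k + 1)) := by
    intro x hx
    rw [norm_mul]
    have h1 : ‖F n x‖ ≤ |C| * (1 + N) ^ k :=
      (hF n x hx).trans (mul_le_mul_of_nonneg_right (le_abs_self C) (by positivity))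
    have h2 : ‖weilMellin g (x + e n * I)‖ ≤ D / (1 + (e n) ^ 2) ^ (k + 1) := by
      have := hD (x + e n * I) (by simpa using abs_sub_half_le_of_mem_uIoc hx)
      simpa using this
    exact mul_le_mul h1 h2 (norm_nonneg _) (by positivity)
  refine (intervalIntegral.norm_integral_le_of_norm_le_const hpt).trans ?_
  -- bookkeeping: `(1+N)^k / (1 + e_n²)^(k+1) ≤ 2^k / N`
  have h1 : (1 + N) ^ k ≤ 2 ^ k * N ^ k := by
    rw [← mul_pow]; exact pow_le_pow_left₀ (by positivity) (by linarith) k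
  have h2 : N ^ k * N ≤ (1 + (e n) ^ 2) ^ (k + 1) := by
    have hsq : N ^ 2 ≤ 1 + (e n) ^ 2 := by
      have := pow_le_pow_left₀ hN0.le (he n) 2
      rw [sq_abs] at this
      linarith
    calc N ^ k * N = N ^ (k + 1) := by ring
      _ ≤ N ^ (2 * (k + 1)) := pow_le_pow_right₀ hN1 (by omega)
      _ = (N ^ 2) ^ (k + 1) := by rw [pow_mul]
      _ ≤ (1 + (e n) ^ 2) ^ (k + 1) := by gcongr
  have h3 : D / (1 + (e n) ^ 2) ^ (k + 1) ≤ D / (N ^ k * N) :=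
    div_le_div_of_nonneg_left hD0 (by positivity) h2
  have hNk : N ^ k ≠ 0 := pow_ne_zero _ hN0.ne'
  calc |C| * (1 + N) ^ k * (D / (1 + (e n) ^ 2) ^ (k + 1)) * |b - a|
      ≤ |C| * (2 ^ k * N ^ k) * (D / (N ^ k * N)) * |b - a| := by gcongr
    _ = |C| * 2 ^ k * D * |b - a| * (1 / N) := by field_simp

/-! ### The zero sum of `c·ξ` over a box is the truncated zero side -/

/-- **The box sum for `F = c·ξ` is `weilZeroSidePartial`.** For `c ≠ 0`, `σ ≥ 1` and `T` not `±` the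
ordinate of a zero, the weighted zero sum of `F` over `(1-σ, σ) × (-T, T)` with multiplicities
`meromorphicOrderAt F` equals `Σ_{|Im ρ| ≤ T} m(ρ) ĝ(ρ)` (the zeros of `ξ` are the non-trivial zeros
of `ζ`, `0 < Re ρ < 1`, with `m(ρ) = riemannZetaZeroOrder ρ`: `untop₀_meromorphicOrderAt_riemannXi`).
[cite: Bombieri2000Weil, §2 Thm. 2] -/
theorem finsum_box_eq_weilZeroSidePartial {F : ℂ → ℂ} {c : ℂ} (hc : c ≠ 0)
    (hF : ∀ s : ℂ, F s = c * riemannXi s) (g : ℝ → ℂ) {σ T : ℝ} (hσ : 1 ≤ σ)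
    (hgood : ∀ s : ℂ, F s = 0 → s.im ≠ T ∧ s.im ≠ -T) :
    ∑ᶠ ρ ∈ {ρ : ℂ | F ρ = 0 ∧ ρ ∈ Set.Ioo (1 - σ) σ ×ℂ Set.Ioo (-T) T},
        ((meromorphicOrderAt F ρ).untop₀ : ℂ) * weilMellin g ρ = weilZeroSidePartial g T := by
  have hF0 : ∀ s : ℂ, F s = 0 ↔ riemannXi s = 0 := fun s ↦ by
    rw [hF s, mul_eq_zero, or_iff_right hc]
  have hset : {ρ : ℂ | F ρ = 0 ∧ ρ ∈ Set.Ioo (1 - σ) σ ×ℂ Set.Ioo (-T) T} = weilZeroIndex T := by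
    ext ρ
    simp only [mem_setOf_eq, Complex.mem_reProdIm, mem_Ioo, weilZeroIndex, hF0]
    constructor
    · rintro ⟨h0, -, hi1, hi2⟩
      obtain ⟨hζ, hre0, hre1, him⟩ := riemannXi_zero_prop h0
      exact ⟨hζ, hre0.le, hre1.le, him, abs_le.2 ⟨hi1.le, hi2.le⟩⟩
    · intro h
      have hmem : ρ ∈ ZetaZeros.riemannZetaNontrivialZeros :=
        ZetaZeros.riemannZetaNontrivialZeros.mem_of_im_ne_zero h.1 h.2.2.2.1
      have habs : |ρ.im| ≤ T := h.2.2.2.2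
      have hξ : riemannXi ρ = 0 := riemannXi_eq_zero_of_mem_riemannZetaNontrivialZeros hmem
      obtain ⟨hne1, hne2⟩ := hgood ρ ((hF0 ρ).2 hξ)
      refine ⟨hξ, ⟨?_, ?_⟩, ?_, ?_⟩
      · linarith [ZetaZeros.riemannZetaNontrivialZeros.re_pos hmem]
      · linarith [ZetaZeros.riemannZetaNontrivialZeros.re_lt_one hmem]
      · exact lt_of_le_of_ne (abs_le.1 habs).1 (Ne.symm hne2)
      · exact lt_of_le_of_ne (abs_le.1 habs).2 hne1
  have hFfun : F = (fun _ : ℂ ↦ c) * riemannXi := funext fun s ↦ by rw [Pi.mul_apply, hF]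
  rw [hset, weilZeroSidePartial]
  refine finsum_mem_congr rfl fun ρ hρ ↦ ?_
  have hmem : ρ ∈ ZetaZeros.riemannZetaNontrivialZeros := by
    rw [weilZeroIndex_eq_inter] at hρ; exact hρ.1
  rw [hFfun, meromorphicOrderAt_mul_of_ne_zero analyticAt_const hc,
    untop₀_meromorphicOrderAt_riemannXi (ZetaZeros.riemannZetaNontrivialZeros.re_pos hmem)
      (ZetaZeros.riemannZetaNontrivialZeros.ne_one hmem)]

/-! ### The Weil transform of a window-supported test function far from the critical line -/

/-- For `g` continuous with `tsupport g ⊆ [-log 3, log 3]` and `0 ≤ A`: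
`‖ĝ(s)‖ ≤ 3^A ∫ ‖g‖` on `|Re s - 1/2| ≤ A` (`e^{A|t|} ≤ 3^A` on the support). [folklore] -/
theorem norm_weilMellin_le_rpow_of_tsupport (hg : Continuous g) (hg' : HasCompactSupport g)
    (hsupp : tsupport g ⊆ Icc (-Real.log 3) (Real.log 3)) {A : ℝ} (hA : 0 ≤ A) {s : ℂ}
    (hs : |s.re - 1 / 2| ≤ A) : ‖weilMellin g s‖ ≤ (3 : ℝ) ^ A * ∫ t : ℝ, ‖g t‖ := by
  refine (norm_weilMellin_le_weilL1W hg hg' hs).trans ?_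
  rw [weilL1W, ← integral_const_mul]
  refine integral_mono_of_nonneg (Eventually.of_forall fun t ↦ by positivity)
    ((hg.norm.const_mul _).integrable_of_hasCompactSupport hg'.norm.mul_left)
    (Eventually.of_forall fun t ↦ ?_)
  by_cases ht : t ∈ tsupport g
  · have habs : |t| ≤ Real.log 3 := abs_le.2 ⟨(hsupp ht).1, (hsupp ht).2⟩
    have hexp : Real.exp (A * |t|) ≤ (3 : ℝ) ^ A := by
      rw [Real.rpow_def_of_pos (by norm_num : (0 : ℝ) < 3), Real.exp_le_exp]
      nlinarith
    simpa [mul_comm] using mul_le_mul_of_nonneg_left hexp (norm_nonneg (g t))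
  · simp [image_eq_zero_of_notMem_tsupport ht]

/-- **Window bound with four integrations by parts**: for a test function `g` supported in
`[-log 3, log 3]`, `0 ≤ A` and `|Re s - 1/2| ≤ A`,
`(‖s - 1/2‖²)² ‖ĝ(s)‖ ≤ 3^A ∫ ‖g⁗‖` (`(g⁗)^ = (s-1/2)⁴ ĝ`, `supp g⁗ ⊆ supp g`).
[cite: Bombieri2000Weil, §2] -/
theorem norm_weilMellin_window_le (hg : IsWeilTest g)
    (hsupp : tsupport g ⊆ Icc (-Real.log 3) (Real.log 3)) {A : ℝ} (hA : 0 ≤ A) {s : ℂ}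
    (hs : |s.re - 1 / 2| ≤ A) :
    (‖s - 1 / 2‖ ^ 2) ^ 2 * ‖weilMellin g s‖ ≤
      (3 : ℝ) ^ A * ∫ t : ℝ, ‖deriv (deriv (deriv (deriv g))) t‖ := by
  have h4 : IsWeilTest (deriv (deriv (deriv (deriv g)))) := hg.deriv.deriv.deriv.deriv
  have hsupp4 : tsupport (deriv (deriv (deriv (deriv g)))) ⊆ Icc (-Real.log 3) (Real.log 3) :=
    tsupport_deriv_subset.trans (tsupport_deriv_subset.trans
      (tsupport_deriv_subset.trans (tsupport_deriv_subset.trans hsupp)))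
  have h := norm_weilMellin_le_rpow_of_tsupport h4.1.continuous h4.2 hsupp4 hA hs
  rwa [weilMellin_deriv_deriv hg.deriv.deriv, weilMellin_deriv_deriv hg, norm_mul, norm_mul,
    norm_pow, ← mul_assoc, ← pow_two] at h

/-- `‖(σ - 1/2) + iy‖² = (σ - 1/2)² + y²` for the two points `s = σ + iy` and `1 - s` of the folded
right edge, and `|Re - 1/2| = σ - 1/2` there. [folklore] -/
theorem norm_sq_sub_half_vertical (σ y : ℝ) :
    ‖((σ : ℂ) + y * I) - 1 / 2‖ ^ 2 = (σ - 1 / 2) ^ 2 + y ^ 2 ∧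
      ‖(1 - ((σ : ℂ) + y * I)) - 1 / 2‖ ^ 2 = (σ - 1 / 2) ^ 2 + y ^ 2 := by
  have e1 : ((σ : ℂ) + y * I) - 1 / 2 = ((σ - 1 / 2 : ℝ) : ℂ) + (y : ℂ) * I := by
    push_cast; ring
  have e2 : (1 - ((σ : ℂ) + y * I)) - 1 / 2 = ((1 / 2 - σ : ℝ) : ℂ) + ((-y : ℝ) : ℂ) * I := by
    push_cast; ring
  rw [e1, e2, Complex.sq_norm, Complex.sq_norm, Complex.normSq_add_mul_I, Complex.normSq_add_mul_I]
  constructor <;> ring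

/-- **The folded right edge against a window-invisible factor is `O(C/(σ - 1/2)²)`, uniformly in
`σ ≥ 3/2`.** For a test function `g` supported in `[-log 3, log 3]` there is `K ≥ 0` such that for
every `σ ≥ 3/2`, `C ≥ 0` and every `V` with `‖V(y)‖ ≤ C · 3^{-σ}`:
`‖∫ V(y) k̂(σ + iy) dy‖ ≤ K C/(σ - 1/2)²`, `k̂ = (weilSymm g)^ = ĝ + ĝ(1-·)`
(`|ĝ(σ+iy)|, |ĝ(1-σ-iy)| ≤ 3^{σ-1/2} ‖g⁗‖₁ /((σ-1/2)²+y²)²` and `((σ-1/2)²+y²)² ≥ (σ-1/2)²(1+y²)`,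
`∫ dy/(1+y²) = π`; the growth `3^{σ-1/2}` is cancelled by `3^{-σ}`). [cite: Bombieri2000Weil, §2] -/
theorem norm_vertical_integral_window_le (hg : IsWeilTest g)
    (hsupp : tsupport g ⊆ Icc (-Real.log 3) (Real.log 3)) :
    ∃ K : ℝ, 0 ≤ K ∧ ∀ (V : ℝ → ℂ) (C σ : ℝ), 3 / 2 ≤ σ → 0 ≤ C →
      (∀ y : ℝ, ‖V y‖ ≤ C * (3 : ℝ) ^ (-σ)) →
      ‖∫ y : ℝ, V y * weilMellin (weilSymm g) (σ + y * I)‖ ≤ K * C / (σ - 1 / 2) ^ 2 := by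
  set L : ℝ := ∫ t : ℝ, ‖deriv (deriv (deriv (deriv g))) t‖ with hL
  have hL0 : 0 ≤ L := integral_nonneg fun _ ↦ norm_nonneg _
  refine ⟨2 * L * π, by positivity, fun V C σ hσ hC hV ↦ ?_⟩
  set a : ℝ := σ - 1 / 2 with ha
  have ha1 : 1 ≤ a := by rw [ha]; linarith
  have ha0 : 0 < a := by linarith
  -- the exponential factors cancel: `3^{-σ} 3^{a} = 3^{-1/2} ≤ 1`
  have h33 : (3 : ℝ) ^ (-σ) * (3 : ℝ) ^ a ≤ 1 := by
    rw [← Real.rpow_add (by norm_num : (0 : ℝ) < 3), ha,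
      show -σ + (σ - 1 / 2) = -(1 / 2 : ℝ) by ring]
    exact Real.rpow_le_one_of_one_le_of_nonpos (by norm_num) (by norm_num)
  -- the bound for `ĝ` at the two points of the folded edge
  have hĝ : ∀ (w : ℂ), |w.re - 1 / 2| ≤ a → ‖w - 1 / 2‖ ^ 2 = a ^ 2 + (w.im) ^ 2 →
      ‖weilMellin g w‖ ≤ (3 : ℝ) ^ a * L / (a ^ 2 * (1 + w.im ^ 2)) := by
    intro w hw hn
    have h := norm_weilMellin_window_le hg hsupp ha0.le hw
    rw [hn] at h
    have hden : 0 < a ^ 2 * (1 + w.im ^ 2) := by positivity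
    rw [le_div_iff₀ hden]
    have hkey : a ^ 2 * (1 + w.im ^ 2) ≤ (a ^ 2 + w.im ^ 2) ^ 2 := by
      nlinarith [sq_nonneg w.im, sq_nonneg a, one_le_pow₀ (n := 2) ha1,
        mul_nonneg (sq_nonneg a) (sq_nonneg w.im)]
    calc ‖weilMellin g w‖ * (a ^ 2 * (1 + w.im ^ 2))
        ≤ ‖weilMellin g w‖ * (a ^ 2 + w.im ^ 2) ^ 2 :=
          mul_le_mul_of_nonneg_left hkey (norm_nonneg _)
      _ = (a ^ 2 + w.im ^ 2) ^ 2 * ‖weilMellin g w‖ := by ring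
      _ ≤ (3 : ℝ) ^ a * L := h
  -- pointwise bound on the line
  have hpt : ∀ y : ℝ, ‖V y * weilMellin (weilSymm g) (σ + y * I)‖ ≤
      (2 * L * C / a ^ 2) * (1 + y ^ 2)⁻¹ := by
    intro y
    obtain ⟨n1, n2⟩ := norm_sq_sub_half_vertical σ y
    have hw1 : |((σ : ℂ) + y * I).re - 1 / 2| ≤ a := by
      have : ((σ : ℂ) + y * I).re - 1 / 2 = a := by simp [ha]
      rw [this, abs_of_pos ha0]
    have hw2 : |(1 - ((σ : ℂ) + y * I)).re - 1 / 2| ≤ a := by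
      have : (1 - ((σ : ℂ) + y * I)).re - 1 / 2 = -a := by simp [ha]; ring
      rw [this, abs_neg, abs_of_pos ha0]
    have b1 := hĝ ((σ : ℂ) + y * I) hw1 (by simpa [ha] using n1)
    have b2 := hĝ (1 - ((σ : ℂ) + y * I)) hw2 (by simpa [ha] using n2)
    simp only [add_im, ofReal_im, mul_im, ofReal_re, I_im, I_re, mul_one, mul_zero, zero_add,
      add_zero, sub_im, one_im, zero_sub, even_two, Even.neg_pow] at b1 b2
    rw [norm_mul, weilMellin_weilSymm hg]
    have hk : ‖weilMellin g (σ + y * I) + weilMellin g (1 - (σ + y * I))‖ ≤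
        2 * ((3 : ℝ) ^ a * L / (a ^ 2 * (1 + y ^ 2))) :=
      (norm_add_le _ _).trans (by linarith)
    have hpos : 0 < a ^ 2 * (1 + y ^ 2) := by positivity
    calc ‖V y‖ * ‖weilMellin g (σ + y * I) + weilMellin g (1 - (σ + y * I))‖
        ≤ (C * (3 : ℝ) ^ (-σ)) * (2 * ((3 : ℝ) ^ a * L / (a ^ 2 * (1 + y ^ 2)))) :=
          mul_le_mul (hV y) hk (norm_nonneg _) (by positivity)
      _ = ((3 : ℝ) ^ (-σ) * (3 : ℝ) ^ a) * (2 * L * C / (a ^ 2 * (1 + y ^ 2))) := by ring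
      _ ≤ 1 * (2 * L * C / (a ^ 2 * (1 + y ^ 2))) :=
          mul_le_mul_of_nonneg_right h33 (by positivity)
      _ = (2 * L * C / a ^ 2) * (1 + y ^ 2)⁻¹ := by field_simp
  -- integrate
  have hmaj : Integrable fun y : ℝ ↦ (2 * L * C / a ^ 2) * (1 + y ^ 2)⁻¹ :=
    integrable_inv_one_add_sq.const_mul _
  calc ‖∫ y : ℝ, V y * weilMellin (weilSymm g) (σ + y * I)‖
      ≤ ∫ y : ℝ, ‖V y * weilMellin (weilSymm g) (σ + y * I)‖ := norm_integral_le_integral_norm _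
    _ ≤ ∫ y : ℝ, (2 * L * C / a ^ 2) * (1 + y ^ 2)⁻¹ :=
        integral_mono_of_nonneg (Eventually.of_forall fun _ ↦ norm_nonneg _) hmaj
          (Eventually.of_forall hpt)
    _ = 2 * L * π * C / (σ - 1 / 2) ^ 2 := by
        rw [integral_const_mul, integral_univ_inv_one_add_sq, ha]; ring

/-! ### Bookkeeping of the limits -/

/-- **Difference of two contour identities in the limit.** If
`2πi S^E_n = b^E_n - t^E_n + i V^E_n` and `2πi S^ξ_n = b^ξ_n - t^ξ_n + i V^ξ_n` for all `n`, the
horizontal pieces tend to `0`, `S^E_n → S`, `S^ξ_n → W` and `V^E_n - V^ξ_n → J`, then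
`2π (S - W) = J`. [folklore] -/
theorem two_pi_mul_sub_eq_of_contour_limits {SE SX bE tE bX tX VE VX : ℕ → ℂ} {S W J : ℂ}
    (hidE : ∀ n, 2 * π * I * SE n = bE n - tE n + I * VE n)
    (hidX : ∀ n, 2 * π * I * SX n = bX n - tX n + I * VX n)
    (hSE : Tendsto SE atTop (𝓝 S)) (hSX : Tendsto SX atTop (𝓝 W))
    (hbE : Tendsto bE atTop (𝓝 0)) (htE : Tendsto tE atTop (𝓝 0))
    (hbX : Tendsto bX atTop (𝓝 0)) (htX : Tendsto tX atTop (𝓝 0))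
    (hV : Tendsto (fun n ↦ VE n - VX n) atTop (𝓝 J)) :
    2 * π * (S - W) = J := by
  have h1 : Tendsto (fun n ↦ 2 * π * I * SE n - 2 * π * I * SX n) atTop
      (𝓝 (2 * π * I * S - 2 * π * I * W)) :=
    (hSE.const_mul _).sub (hSX.const_mul _)
  have h2 : Tendsto (fun n ↦ (bE n - bX n) - (tE n - tX n) + I * (VE n - VX n)) atTop
      (𝓝 ((0 - 0) - (0 - 0) + I * J)) :=
    ((hbE.sub hbX).sub (htE.sub htX)).add (hV.const_mul I)
  have h3 : (fun n ↦ 2 * π * I * SE n - 2 * π * I * SX n) =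
      fun n ↦ (bE n - bX n) - (tE n - tX n) + I * (VE n - VX n) := by
    funext n; rw [hidE, hidX]; ring
  rw [h3] at h1
  have h4 := tendsto_nhds_unique h1 h2
  have h5 : I * (2 * π * (S - W)) = I * J := by linear_combination h4
  exact mul_left_cancel₀ I_ne_zero h5

end Literature.NumberTheory.LFunctions

end
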